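import Summits.ResolutionOfSingularities.ResolutionOfSingularities.Theses.FoliationDescent
import Summits.ResolutionOfSingularities.ResolutionOfSingularities.Theses.ShadowGame
import Summits.ResolutionOfSingularities.ResolutionOfSingularities.Theses.Valuative
import Summits.ResolutionOfSingularities.ResolutionOfSingularities.Theorems.ValuativeLuAlphaPTorsorKnownRanges
import Literature.AlgebraicGeometry.Resolution.ResolutionLU
import HarnessLib

/-!
# Negative lemmas for crux `DualSandwich` (stmt-ResolutionOfSingularities-17083): the crux, every
# hypothesis-mutation of it and the Frobenius-top stub are refutable only by a counterexample to
# resolution of singularities in positive characteristic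

Route `ResolutionOfSingularities/FoliationDescent`, crux #4 (rank 4, "consumed reduction"):

  `DualSandwich := FolLU → LogCanQuotLU → TorsorLUPerfect`

(foliation local uniformization and log-canonical quotient uniformization give local
uniformization of `α_p`-torsors `t ^ p = a` over bases regular at the centre, over perfect ground
fields, by the double Frobenius sandwich `K₀(t) ⊆ K₀^{1/p} ⊇ A₀^{1/p}` and degree-`p` descents).

Findings of the standing disprover (cdisprove, cycle 1), all PROVED here (no `sorry`, no new
definition; axioms ⊆ {propext, Classical.choice, Quot.sound}):

* §1 WEB. The consequent `TorsorLUPerfect` is ShadowGame's target stmt-16158 verbatim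
  (`torsorLUPerfect_iff_shadowGame`) and is Valuative's `LuAlphaPTorsor` (stmt-0641) restricted to
  perfect ground fields; the summit implies `LuAlphaPTorsor` (resolution in characteristic `p` ⇒
  relative local uniformization, tree `ResolutionInChar.relLocalUniformization`, applied to the
  model `k[A₀, t]` — `t ∈ O` because `t ^ p ∈ A₀ ⊆ O`), hence the consequent, hence the crux. So
  (`not_resolutionOfSingularities_of_not_dualSandwich`) **an unconditional `¬ DualSandwich` is a
  counterexample to resolution of singularities in positive characteristic**; logically
  (`not_dualSandwich_iff`) it is `FolLU ∧ LogCanQuotLU ∧ ¬ TorsorLUPerfect` — proofs of the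
  route's two open cruxes AND a failure of LU of `α_p`-torsors over some perfect field.
* §2 LOAD-BEARING ANALYSIS, pushed as far as it goes. Dropping `FolLU`, dropping `LogCanQuotLU`,
  or dropping perfectness from the consequent (`FolLU → LogCanQuotLU → LuAlphaPTorsor`) each
  gives a statement that still implies the crux and is still implied by the summit
  (`not_resolutionOfSingularities_of_not_without…`). Hence no `dualSandwich_false_without_<H>`
  lemma exists short of `¬ ResolutionOfSingularities`: the two cruxes and `[PerfectField k]` are
  load-bearing for the MECHANISM only (the sandwich consumes `FolLU`/`LogCanQuotLU` once per
  degree-`p` descent at `D = d/dy`; perfectness makes the Frobenius top `A₀^{1/p}` finitely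
  generated), never for the truth value.
* §3 THE FROBENIUS-TOP STUB of the picked line `birth` (`Cruxes/DualSandwich/Lines/birth.lean`,
  `FrobeniusTop`, inlined verbatim below) is implied by the consequent itself — take the trivial
  top `L := K`, `O' := O`, `B :=` the uniformizing model, `R := k[A₀, t]`
  (`not_torsorLUPerfect_of_not_frobeniusTop`) — hence by the summit: it cannot be false either;
  its content is only that the intended witness `L = K₀^{1/p}`, `B = A₀^{1/p} ≅ A₀` avoids this
  circularity.
* §5 THE CHAIN STUB `RelChain p` (inlined verbatim) is relative LU of `O ∩ K ∋ R` for `K/k`,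
  which is finitely generated because `K ⊆ L = Frac B` with `[L : K] < ∞`
  (`fg_top_of_fg_top_of_isPurelyInseparable`, finite generation descends along a finite purely
  inseparable extension); resolution in characteristic `p` gives it
  (`not_resolutionOfSingularities_of_not_relChain`, via the tree's `lurel_of_resolutionInChar`).
  `RelStep p` is its special case (height-one simple extensions are finite) and is moreover
  PROVED from `FolLU ∧ LogCanQuotLU` (evidence `StubRelStepProof.lean` on the item). So no stub of
  the picked line can be killed by a counterexample; the line's only risk is formalization cost.

Informal (not formalised here, see `Cruxes/DualSandwich/Disproof.lean` and `ATTACK-refuter.md`):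
degenerate regimes `t ∈ Frac A₀`, `O = K`, `trdeg ≤ 1`, codimension-one centres, `n = 0` are all
consistent with the typing; the hypotheses of `FolLU` / `LogCanQuotLU` / `TorsorLUPerfect` are
jointly satisfiable with true conclusions (`k = 𝔽_p`, `K = k(x)`, `D = d/dx`), so nothing is
vacuous.
-/

noncomputable section

open Summit.ResolutionOfSingularities.ResolutionOfSingularities.Theses
open Summit.ResolutionOfSingularities.ResolutionOfSingularities.Theses.FoliationDescent
  (FolLU LogCanQuotLU TorsorLUPerfect DualSandwich)
open Literature.AlgebraicGeometry.Resolution (ResolutionInChar isFractionRing_of_le)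
open Summit.ResolutionOfSingularities.ResolutionOfSingularities.Theorems.PfaffLine
  (mem_valuationSubring_of_pow_mem adjoin_insert_toSubring_le le_adjoin_insert mem_adjoin_insert
    fg_adjoin_insert intermediateField_top_fg_of_isFractionRing)

set_option linter.dupNamespace false

namespace Summit.ResolutionOfSingularities.ResolutionOfSingularities.Theorems.DualSandwich.Negative

/-! ## Helpers (the torsor-model bookkeeping `t ∈ O`, `k[A₀, t] ⊆ O`, `A₀ ≤ k[A₀, t] ∋ t`,
finite generation is reused from `Theorems/ValuativeLuAlphaPTorsorBirationalExit.lean`) -/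

section Helpers

variable {k K : Type} [Field k] [Field K] [Algebra k K]

/-- `A₀[t] ≤ A` as soon as `A₀ ≤ A` and `t ∈ A`. [folklore] -/
theorem adjoin_insert_le_of (A₀ A : Subalgebra k K) (t : K) (h : A₀ ≤ A) (ht : t ∈ A) :
    Algebra.adjoin k (insert t (A₀ : Set K)) ≤ A :=
  Algebra.adjoin_le (Set.insert_subset_iff.mpr ⟨ht, h⟩)

end Helpers

/-! ## §1 Web: a refutation of the crux refutes the summit -/

/-- The consequent `TorsorLUPerfect` of route FoliationDescent is byte-identical to ShadowGame's
target (stmt-16158). [folklore] -/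
theorem torsorLUPerfect_iff_shadowGame : TorsorLUPerfect ↔ ShadowGame.TorsorLUPerfect := Iff.rfl

/-- **A failure of Valuative's `LuAlphaPTorsor` (stmt-0641) is a failure of the summit**:
resolution in characteristic `p` gives relative local uniformization (tree, Zariski read
backwards), which uniformizes the model `k[A₀, t] ⊆ O` (`t ∈ O` as `t ^ p ∈ A₀ ⊆ O`); neither
the regularity of `A₀` at the centre nor the torsor shape is used. [folklore] -/
theorem not_resolutionOfSingularities_of_not_luAlphaPTorsor (h : ¬ Valuative.LuAlphaPTorsor) :
    ¬ _root_.ResolutionOfSingularities := by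
  intro hR
  apply h
  intro p hp k K _ _ _ _ O A₀ h₀ t hfg htp hfr _hreg
  have htO : t ∈ O := mem_valuationSubring_of_pow_mem O hp.ne_zero (h₀ htp)
  have hRO := adjoin_insert_toSubring_le O.toSubring A₀ h₀ htO
  obtain ⟨A, h, hRA, hAfg, hreg⟩ :=
    (hR p hp).relLocalUniformization k K O _ (fg_adjoin_insert hfg t) hfr hRO
  exact ⟨A, h, (le_adjoin_insert A₀ t).trans hRA, hRA (mem_adjoin_insert A₀ t), hAfg,
    isFractionRing_of_le hRA hfr, hreg⟩

/-- A failure of the consequent `TorsorLUPerfect` is a failure of `LuAlphaPTorsor` (the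
perfectness instance is simply discarded) … [folklore] -/
theorem not_luAlphaPTorsor_of_not_torsorLUPerfect (h : ¬ TorsorLUPerfect) :
    ¬ Valuative.LuAlphaPTorsor :=
  fun H => h fun p hp k K _ _ _ _ _ O A₀ h₀ t => H p hp k K O A₀ h₀ t

/-- … hence of the summit. [folklore] -/
theorem not_resolutionOfSingularities_of_not_torsorLUPerfect (h : ¬ TorsorLUPerfect) :
    ¬ _root_.ResolutionOfSingularities :=
  not_resolutionOfSingularities_of_not_luAlphaPTorsor (not_luAlphaPTorsor_of_not_torsorLUPerfect h)

/-- **What a kill would have to be**: proofs of BOTH open cruxes of the route and a refutation of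
LU of `α_p`-torsors over some perfect field. [folklore] -/
theorem not_dualSandwich_iff : ¬ DualSandwich ↔ (FolLU ∧ LogCanQuotLU ∧ ¬ TorsorLUPerfect) := by
  change ¬ (FolLU → LogCanQuotLU → TorsorLUPerfect) ↔ _
  rw [Classical.not_imp, Classical.not_imp]

/-! ## §2 Load-bearing analysis: every hypothesis-mutation lies between the crux and the summit -/

/-- Dropping `FolLU` STRENGTHENS the crux … [folklore] -/
theorem not_withoutFolLU_of_not_dualSandwich (h : ¬ DualSandwich) :
    ¬ (LogCanQuotLU → TorsorLUPerfect) :=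
  fun H => h fun _ hQ => H hQ

/-- … but the strengthening is still implied by the summit: no `dualSandwich_false_without_FolLU`
short of `¬ ResolutionOfSingularities`. [folklore] -/
theorem not_resolutionOfSingularities_of_not_withoutFolLU (h : ¬ (LogCanQuotLU → TorsorLUPerfect)) :
    ¬ _root_.ResolutionOfSingularities :=
  not_resolutionOfSingularities_of_not_torsorLUPerfect fun H => h fun _ => H

/-- Dropping `LogCanQuotLU` STRENGTHENS the crux … [folklore] -/
theorem not_withoutLogCanQuotLU_of_not_dualSandwich (h : ¬ DualSandwich) :
    ¬ (FolLU → TorsorLUPerfect) :=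
  fun H => h fun hF _ => H hF

/-- … but is still implied by the summit: no `dualSandwich_false_without_LogCanQuotLU` short of
`¬ ResolutionOfSingularities`. [folklore] -/
theorem not_resolutionOfSingularities_of_not_withoutLogCanQuotLU (h : ¬ (FolLU → TorsorLUPerfect)) :
    ¬ _root_.ResolutionOfSingularities :=
  not_resolutionOfSingularities_of_not_torsorLUPerfect fun H => h fun _ => H

/-- Dropping perfectness of the ground field from the consequent (`FolLU`, `LogCanQuotLU` are
only stated over perfect fields, so this is the strongest reading of "drop `[PerfectField k]`")
STRENGTHENS the crux … [folklore] -/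
theorem not_withoutPerfect_of_not_dualSandwich (h : ¬ DualSandwich) :
    ¬ (FolLU → LogCanQuotLU → Valuative.LuAlphaPTorsor) :=
  fun H => h fun hF hQ p hp k K _ _ _ _ _ O A₀ h₀ t => H hF hQ p hp k K O A₀ h₀ t

/-- … but is still implied by the summit: no `dualSandwich_false_without_PerfectField` short of
`¬ ResolutionOfSingularities` (perfectness is load-bearing for the MECHANISM — the Frobenius top
`A₀^{1/p}` is finitely generated over `k` iff `[k : k^p] < ∞`, and is the intended regular top
only for `k` perfect — not for the truth value). [folklore] -/
theorem not_resolutionOfSingularities_of_not_withoutPerfect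
    (h : ¬ (FolLU → LogCanQuotLU → Valuative.LuAlphaPTorsor)) :
    ¬ _root_.ResolutionOfSingularities :=
  not_resolutionOfSingularities_of_not_luAlphaPTorsor fun H => h fun _ _ => H

/-! ## §3 Consequences for the crux: a refutation of `DualSandwich` refutes target and summit -/

/-- A refutation of the crux refutes its consequent, the route target `TorsorLUPerfect`
(the glue is WEAKER than the target it feeds: `TorsorLUPerfect → DualSandwich` discards both
cruxes). [folklore] -/
theorem not_torsorLUPerfect_of_not_dualSandwich (h : ¬ DualSandwich) : ¬ TorsorLUPerfect :=
  (not_dualSandwich_iff.mp h).2.2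

/-- … equivalently ShadowGame's target stmt-16158 (shared with WildCones / FrobeniusClosing) …
[folklore] -/
theorem not_shadowGameTorsorLUPerfect_of_not_dualSandwich (h : ¬ DualSandwich) :
    ¬ ShadowGame.TorsorLUPerfect :=
  fun H => not_withoutFolLU_of_not_dualSandwich h fun _ => torsorLUPerfect_iff_shadowGame.mpr H

/-- … hence Valuative's `LuAlphaPTorsor` (stmt-0641) … [folklore] -/
theorem not_luAlphaPTorsor_of_not_dualSandwich (h : ¬ DualSandwich) : ¬ Valuative.LuAlphaPTorsor :=
  fun H => not_withoutPerfect_of_not_dualSandwich h fun _ _ => H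

/-- **… hence the summit: an unconditional `¬ DualSandwich` is a counterexample to resolution of
singularities in positive characteristic.** So the crux is not refutable by any cheap means.
[folklore] -/
theorem not_resolutionOfSingularities_of_not_dualSandwich (h : ¬ DualSandwich) :
    ¬ _root_.ResolutionOfSingularities :=
  not_resolutionOfSingularities_of_not_withoutLogCanQuotLU
    (not_withoutLogCanQuotLU_of_not_dualSandwich h)

/-! ## §4 The Frobenius-top stub of line `birth` is implied by the consequent -/

/-- **`¬ FrobeniusTop → ¬ TorsorLUPerfect`** (`FrobeniusTop` of `Cruxes/DualSandwich/Lines/birth.lean`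
inlined verbatim): given the consequent, the trivial top `L := K`, `O' := O`, `B :=` the
uniformizing model `A ⊇ k[A₀, t]`, `R := k[A₀, t]` witnesses the stub. So `stub_frobeniusTop`
cannot be false unless LU of `α_p`-torsors over a perfect field fails. [folklore] -/
theorem not_torsorLUPerfect_of_not_frobeniusTop
    (h : ¬ ∀ p : ℕ, p.Prime → ∀ (k K : Type) [Field k] [CharP k p] [PerfectField k] [Field K]
      [Algebra k K] (O : ValuationSubring K) (A₀ : Subalgebra k K)
      (h₀ : A₀.toSubring ≤ O.toSubring) (t : K), A₀.FG → t ^ p ∈ A₀ →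
      IsFractionRing (Algebra.adjoin k (insert t (A₀ : Set K))) K →
      IsRegularLocalRing (Localization.AtPrime
        (Ideal.comap (Subring.inclusion h₀) (IsLocalRing.maximalIdeal O))) →
      ∃ (L : Type) (_ : Field L) (_ : Algebra k L) (_ : Algebra K L) (_ : IsScalarTower k K L)
        (_ : FiniteDimensional K L) (_ : IsPurelyInseparable K L) (O' : ValuationSubring L)
        (B : Subalgebra k L) (hB : B.toSubring ≤ O'.toSubring) (R : Subalgebra k K),
        O'.comap (algebraMap K L) = O ∧ B.FG ∧ IsFractionRing B L ∧
        IsRegularLocalRing (Localization.AtPrime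
          (Ideal.comap (Subring.inclusion hB) (IsLocalRing.maximalIdeal O'))) ∧
        A₀ ≤ R ∧ t ∈ R ∧ R.FG ∧ R.map (IsScalarTower.toAlgHom k K L) ≤ B) :
    ¬ TorsorLUPerfect := by
  intro hT
  apply h
  intro p hp k K _ _ _ _ _ O A₀ h₀ t hfg htp hfr hreg
  obtain ⟨A, hA, hA₀A, htA, hAfg, hAfr, hAreg⟩ := hT p hp k K O A₀ h₀ t hfg htp hfr hreg
  refine ⟨K, inferInstance, inferInstance, inferInstance, inferInstance, inferInstance,
    inferInstance, O, A, hA, Algebra.adjoin k (insert t (A₀ : Set K)), ?_, hAfg, hAfr, hAreg,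
    le_adjoin_insert A₀ t, mem_adjoin_insert A₀ t, fg_adjoin_insert hfg t, ?_⟩
  · ext x
    simp [ValuationSubring.mem_comap]
  · rw [Subalgebra.map_le]
    intro x hx
    simpa using adjoin_insert_le_of A₀ A t hA₀A htA hx

/-- Hence no `stub_frobeniusTop_false` short of `¬ ResolutionOfSingularities`. [folklore] -/
theorem not_resolutionOfSingularities_of_not_frobeniusTop
    (h : ¬ ∀ p : ℕ, p.Prime → ∀ (k K : Type) [Field k] [CharP k p] [PerfectField k] [Field K]
      [Algebra k K] (O : ValuationSubring K) (A₀ : Subalgebra k K)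
      (h₀ : A₀.toSubring ≤ O.toSubring) (t : K), A₀.FG → t ^ p ∈ A₀ →
      IsFractionRing (Algebra.adjoin k (insert t (A₀ : Set K))) K →
      IsRegularLocalRing (Localization.AtPrime
        (Ideal.comap (Subring.inclusion h₀) (IsLocalRing.maximalIdeal O))) →
      ∃ (L : Type) (_ : Field L) (_ : Algebra k L) (_ : Algebra K L) (_ : IsScalarTower k K L)
        (_ : FiniteDimensional K L) (_ : IsPurelyInseparable K L) (O' : ValuationSubring L)
        (B : Subalgebra k L) (hB : B.toSubring ≤ O'.toSubring) (R : Subalgebra k K),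
        O'.comap (algebraMap K L) = O ∧ B.FG ∧ IsFractionRing B L ∧
        IsRegularLocalRing (Localization.AtPrime
          (Ideal.comap (Subring.inclusion hB) (IsLocalRing.maximalIdeal O'))) ∧
        A₀ ≤ R ∧ t ∈ R ∧ R.FG ∧ R.map (IsScalarTower.toAlgHom k K L) ≤ B) :
    ¬ _root_.ResolutionOfSingularities :=
  not_resolutionOfSingularities_of_not_torsorLUPerfect (not_torsorLUPerfect_of_not_frobeniusTop h)


/-! ## §5 The chain stub of line `birth` is summit-implied (relative LU for `O ∩ K`) -/

/-- **Finite generation descends along a finite purely inseparable extension**: if `L/k` is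
finitely generated as a field and `L/K` is finite purely inseparable, then `K/k` is finitely
generated as a field (`q = (exp. char.)^(exponent)` sends `L` into `K`; `K' = k(z_i^q)` for
generators `z_i` of `L/k` is finitely generated, `L/K'` is finite, hence so is `K/K'`).
[folklore] -/
theorem fg_top_of_fg_top_of_isPurelyInseparable {k K L : Type} [Field k] [Field K] [Field L]
    [Algebra k K] [Algebra K L] [Algebra k L] [IsScalarTower k K L] [FiniteDimensional K L]
    [IsPurelyInseparable K L] (hL : (⊤ : IntermediateField k L).FG) :
    (⊤ : IntermediateField k K).FG := by
  classical
  obtain ⟨s, hs⟩ := hL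
  set q : ℕ := ringExpChar K ^ IsPurelyInseparable.exponent K L with hq
  have hq0 : q ≠ 0 := (expChar_pow_pos K (ringExpChar K) _).ne'
  have hmem : ∀ z : L, ∃ c : K, algebraMap K L c = z ^ q := fun z =>
    IsPurelyInseparable.exponent_def K z
  choose c hc using hmem
  set K' : IntermediateField k K := IntermediateField.adjoin k ((s.image c : Finset K) : Set K)
    with hK'
  have hK'fg : (⊤ : IntermediateField k K').FG :=
    IntermediateField.fg_top_iff.mpr
      (IntermediateField.essFiniteType_iff.mpr ⟨s.image c, rfl⟩)
  have hint : ∀ z ∈ (s : Set L), IsIntegral K' z := by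
    intro z hz
    have hcz : c z ∈ K' := IntermediateField.subset_adjoin k _
      (by exact_mod_cast Finset.mem_image_of_mem c hz)
    refine ⟨Polynomial.X ^ q - Polynomial.C ⟨c z, hcz⟩, Polynomial.monic_X_pow_sub_C _ hq0, ?_⟩
    have : algebraMap K' L ⟨c z, hcz⟩ = z ^ q := hc z
    simp [this]
  haveI : FiniteDimensional K' L := by
    have htop : IntermediateField.adjoin K' (s : Set L) = ⊤ := by
      apply top_le_iff.mp
      intro x _
      have hx : x ∈ IntermediateField.adjoin k (s : Set L) := by rw [hs]; trivial
      have hle : IntermediateField.adjoin k (s : Set L) ≤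
          (IntermediateField.adjoin K' (s : Set L)).restrictScalars k :=
        IntermediateField.adjoin_le_iff.mpr (IntermediateField.subset_adjoin K' _)
      exact hle hx
    have hfd : FiniteDimensional K' (IntermediateField.adjoin K' (s : Set L)) :=
      IntermediateField.finiteDimensional_adjoin hint
    rw [htop] at hfd
    exact IntermediateField.topEquiv.toLinearEquiv.finiteDimensional
  haveI : FiniteDimensional K' K :=
    FiniteDimensional.of_injective (IsScalarTower.toAlgHom K' K L).toLinearMap
      (algebraMap K L).injective
  haveI : Algebra.EssFiniteType k K' := IntermediateField.fg_top_iff.mp hK'fg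
  haveI : Algebra.EssFiniteType K' K := inferInstance
  exact IntermediateField.fg_top_iff.mpr (Algebra.EssFiniteType.comp k K' K)

/-- **`¬ RelChain p → ¬ Res`** (`RelChain` of `Cruxes/DualSandwich/Lines/birth.lean` inlined
verbatim, `p` prime): the chain stub is relative local uniformization of `O ∩ K ∋ R` for the
field `K/k`, finitely generated by `fg_top_of_fg_top_of_isPurelyInseparable` (`K ⊆ L = Frac B`,
`[L : K] < ∞`), which resolution in characteristic `p` gives (tree `lurel_of_resolutionInChar`);
the regular top `B` serves only to make `L` finitely generated and `k ⊆ O`. So `stub_relChain`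
(and its special case `stub_relStep`, height-one simple extensions being finite) cannot be false
short of `¬ ResolutionOfSingularities`. [folklore] -/
theorem not_resolutionOfSingularities_of_not_relChain {p : ℕ} (hp : p.Prime)
    (h : ¬ ∀ (k K L : Type) [Field k] [CharP k p] [PerfectField k] [Field K] [Field L] [Algebra k K]
      [Algebra K L] [Algebra k L] [IsScalarTower k K L] [FiniteDimensional K L]
      [IsPurelyInseparable K L] (O : ValuationSubring L) (B : Subalgebra k L)
      (hB : B.toSubring ≤ O.toSubring) (R : Subalgebra k K), B.FG → IsFractionRing B L →
      IsRegularLocalRing (Localization.AtPrime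
        (Ideal.comap (Subring.inclusion hB) (IsLocalRing.maximalIdeal O))) →
      R.FG → R.map (IsScalarTower.toAlgHom k K L) ≤ B →
      ∃ (A : Subalgebra k K) (hA : A.toSubring ≤ (O.comap (algebraMap K L)).toSubring),
        R ≤ A ∧ A.FG ∧ IsFractionRing A K ∧
        IsRegularLocalRing (Localization.AtPrime
          (Ideal.comap (Subring.inclusion hA)
            (IsLocalRing.maximalIdeal (O.comap (algebraMap K L)))))) :
    ¬ _root_.ResolutionOfSingularities := by
  intro hRes
  apply h
  intro k K L _ _ _ _ _ _ _ _ _ _ _ O B hB R hBfg hBfr _hBreg hRfg hRB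
  haveI : IsFractionRing B L := hBfr
  have hLfg : (⊤ : IntermediateField k L).FG := intermediateField_top_fg_of_isFractionRing B hBfg
  have hKfg : (⊤ : IntermediateField k K).FG := fg_top_of_fg_top_of_isPurelyInseparable hLfg
  have hO : ∀ c : k, algebraMap k K c ∈ O.comap (algebraMap K L) := by
    intro c
    rw [ValuationSubring.mem_comap, ← IsScalarTower.algebraMap_apply]
    exact hB (B.algebraMap_mem c)
  have hRO : R.toSubring ≤ (O.comap (algebraMap K L)).toSubring := by
    intro x hx
    change x ∈ O.comap (algebraMap K L)
    rw [ValuationSubring.mem_comap]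
    exact hB (hRB (Subalgebra.mem_map.mpr ⟨x, hx, rfl⟩))
  obtain ⟨A, hA, hRA, hAfg, hAfr, hreg⟩ :=
    Literature.AlgebraicGeometry.Resolution.lurel_of_resolutionInChar p hp (hRes p hp) k K hKfg
      (O.comap (algebraMap K L)) hO R hRfg hRO
  exact ⟨A, hA, hRA, hAfg, hAfr, hreg⟩

end Summit.ResolutionOfSingularities.ResolutionOfSingularities.Theorems.DualSandwich.Negative

end
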